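import Summits.CriticalPhenomena.CardyFormulaZ2.Theorems.CardySelfRefinementLagHandOffNoIdleAuxAlternation
import HarnessLib

/-!
# No idling of the limit interface, part 7: a curve idling inside its past range has many
alternation points on every fine grid

Helper file for the registered stub `stub_limitCurveRegularity_noIdle` of line
`hitting-tournament` of crux `LagHandOff` (stmt-CriticalPhenomena-10268).  The deterministic
heart of the first-moment argument.  Let `c₀` be a LIGHT curve (no interval of constancy) in
the closure of a Dobrushin domain `D`, with both ends on `∂D`, tracing no boundary arc (every
piece `c₀[p, q] ⊆ ∂D` is a point), which during `(s, t)` stays inside its past range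
`c₀[0, s]`.  Then there is `R₀ > 0` such that for all `0 < R ≤ R₀`, all `ε` with
`1000ε ≤ R` and every square grid `εℤ² ∩ [-Lε, Lε]²` covering the trace, at least
`⌊R/ε⌋ + 1` grid points `g` at distance `≥ 2R` from `∂D` see the class of `c₀` in the
alternation event `altEvent g (2ε) R` (`exists_forall_le_card_filter_altEvent`).

Proof.  By the no-trace property and lightness some time of `(s, t)` is mapped into the
(open) domain; by continuity and lightness there are `s < p < q < t` with `c₀ p ≠ c₀ q` and
`c₀[p, q]` at distance `≥ 2μ/3` from `∂D`.  Project `c₀[p, q]` orthogonally on the chord from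
`c₀ p` to `c₀ q` (length `d`): every level in `[d/2, d]` is attained (intermediate values),
so the `⌊R/ε⌋ + 1` levels `d/2 + 3εi` give points `zᵢ = c₀ uᵢ` of the piece, pairwise `≥ 3ε`
apart and `≥ d/2` from `c₀ p`.  Each `zᵢ` is also a past point `c₀ u₁`, `u₁ ≤ s`, so at the
nearest grid point `gᵢ` (within `ε`) the curve alternates: near at `u₁`, far at `p`
(`d/2 - ε > R` for `R ≤ d/8`), near at `uᵢ`, far at both ends (on `∂D`, at distance
`≥ 2μ/3 - ε > R` for `R ≤ μ/6`); the `gᵢ` are distinct, in the grid, and in the bulk.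

Also here: the square grid `sqGrid ε L` with its cardinality bound.

References: M. Aizenman, A. Burchard, Duke Math. J. 99 (1999), §1.b, §2 (traversal counts of
shells as curve functionals); A. Kemppainen, S. Smirnov, Ann. Probab. 45 (2017), Thm. 1.5
(the statement being proved for the bond-`ℤ²` interface: no idling of the limit curve).
-/

noncomputable section

open Set Filter Topology Metric
open scoped unitInterval
open Literature.Probability.Percolation Literature.Probability.RandomPlanarGeometry

namespace Summit.CriticalPhenomena.CardyFormulaZ2.Cruxes.LagHandOff.HittingTournament

/-! ### The square grid -/

/-- **The square grid** `εℤ² ∩ [-Lε, Lε]²` as a finite set of points of the plane. -/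
def sqGrid (ε : ℝ) (L : ℕ) : Finset ℂ :=
  ((Finset.Icc (-(L : ℤ)) L) ×ˢ (Finset.Icc (-(L : ℤ)) L)).image
    fun p : ℤ × ℤ => ((ε * p.1 : ℝ) : ℂ) + ((ε * p.2 : ℝ) : ℂ) * Complex.I

/-- The square grid has at most `(2L+1)²` points. -/
theorem card_sqGrid_le (ε : ℝ) (L : ℕ) : (sqGrid ε L).card ≤ (2 * L + 1) ^ 2 := by
  refine Finset.card_image_le.trans ?_
  rw [Finset.card_product, Int.card_Icc, sq]
  have : ((L : ℤ) + 1 - -(L : ℤ)).toNat = 2 * L + 1 := by omega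
  rw [this]

/-- A point `ε(m + n i)` with `|m|, |n| ≤ L` is a grid point. -/
theorem mem_sqGrid {ε : ℝ} {L : ℕ} {m n : ℤ} (hm : |m| ≤ L) (hn : |n| ≤ L) :
    ((ε * m : ℝ) : ℂ) + ((ε * n : ℝ) : ℂ) * Complex.I ∈ sqGrid ε L := by
  rw [sqGrid, Finset.mem_image]
  refine ⟨(m, n), Finset.mem_product.2 ⟨Finset.mem_Icc.2 (abs_le.1 hm), Finset.mem_Icc.2 (abs_le.1 hn)⟩,
    rfl⟩

/-- Rounding to the grid moves each coordinate by at most `ε/2`, the point by at most `ε`. -/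
theorem dist_round_grid_le {ε : ℝ} (hε : 0 < ε) (z : ℂ) :
    dist (((ε * round (z.re / ε) : ℝ) : ℂ) + ((ε * round (z.im / ε) : ℝ) : ℂ) * Complex.I) z ≤ ε := by
  have key : ∀ x : ℝ, |ε * round (x / ε) - x| ≤ ε / 2 := fun x => by
    have h := abs_sub_round (x / ε)
    have : ε * (round (x / ε) : ℝ) - x = -(ε * (x / ε - round (x / ε))) := by
      field_simp; ring
    rw [this, abs_neg, abs_mul, abs_of_pos hε]
    nlinarith
  rw [Complex.dist_eq]
  refine (Complex.norm_le_abs_re_add_abs_im _).trans ?_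
  have hre : (((ε * round (z.re / ε) : ℝ) : ℂ) + ((ε * round (z.im / ε) : ℝ) : ℂ) * Complex.I - z).re =
      ε * round (z.re / ε) - z.re := by simp
  have him : (((ε * round (z.re / ε) : ℝ) : ℂ) + ((ε * round (z.im / ε) : ℝ) : ℂ) * Complex.I - z).im =
      ε * round (z.im / ε) - z.im := by simp
  rw [hre, him]
  linarith [key z.re, key z.im]

/-- The rounded coordinate of a point of norm `≤ Rad` is at most `Rad/ε + 1` in size. -/
theorem abs_round_div_le {ε Rad x : ℝ} (hε : 0 < ε) (hx : |x| ≤ Rad) :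
    |(round (x / ε) : ℝ)| ≤ Rad / ε + 1 := by
  have h := abs_sub_round (x / ε)
  have h1 : |(round (x / ε) : ℝ)| ≤ |x / ε| + 1 / 2 := by
    have := abs_sub_abs_le_abs_sub (round (x / ε) : ℝ) (x / ε)
    rw [abs_sub_comm] at h
    linarith
  have h2 : |x / ε| ≤ Rad / ε := by
    rw [abs_div, abs_of_pos hε]; exact div_le_div_of_nonneg_right hx hε.le
  linarith

/-! ### Many alternation points for a light curve idling inside its past range -/

open scoped Classical in
/-- **A light curve idling inside its past range has many bulk alternation points on every
fine grid.** See the module docstring for the statement and the proof.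
[cite: KemppainenSmirnov2017, Thm. 1.5] [cite: AizenmanBurchardDuke1999, §1.b] -/
theorem exists_forall_le_card_filter_altEvent (D : DobrushinDomain) {c₀ : Curve ℂ}
    (hlight : ∀ s t : I, s < t → ∃ u, s ≤ u ∧ u ≤ t ∧ c₀ u ≠ c₀ s)
    (hcl : ∀ u, c₀ u ∈ closure D.carrier) (h0 : c₀ 0 ∈ frontier D.carrier)
    (h1 : c₀ 1 ∈ frontier D.carrier)
    (hnt : ∀ p q : I, p < q → c₀ '' Icc p q ⊆ frontier D.carrier → (c₀ '' Icc p q).Subsingleton)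
    {s t : I} (hst : s < t) (hpast : ∀ u ∈ Ioo s t, c₀ u ∈ c₀ '' Icc 0 s)
    {Rad : ℝ} (hRad : ∀ u, ‖c₀ u‖ ≤ Rad) :
    ∃ R₀ : ℝ, 0 < R₀ ∧ ∀ R : ℝ, 0 < R → R ≤ R₀ → ∀ ε : ℝ, 0 < ε → 1000 * ε ≤ R →
      ∀ L : ℕ, Rad / ε + 1 ≤ L →
        ⌊R / ε⌋₊ + 1 ≤ ((sqGrid ε L).filter fun g =>
          2 * R ≤ infDist g (frontier D.carrier) ∧ CurveClass.mk c₀ ∈ altEvent g (2 * ε) R).card := by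
  classical
  have hopen := D.isOpen
  ---------------------------------------------------------------- an interior time in `(s, t)`
  have hint : ∃ u₀ ∈ Ioo s t, c₀ u₀ ∈ D.carrier := by
    by_contra H
    push Not at H
    have hfr : ∀ u ∈ Ioo s t, c₀ u ∈ frontier D.carrier := fun u hu => by
      rw [hopen.frontier_eq]; exact ⟨hcl u, H u hu⟩
    have hs' : c₀ s ∈ frontier D.carrier := by
      by_contra hs
      obtain ⟨u, hu, hu'⟩ :=
        exists_mem_Ioo_mem_of_isOpen c₀ isClosed_frontier.isOpen_compl hst hs
      exact hu' (hfr u hu)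
    have ht' : c₀ t ∈ frontier D.carrier := by
      by_contra ht
      have hopen' : IsOpen ((c₀ : I → ℂ) ⁻¹' (frontier D.carrier)ᶜ) :=
        isClosed_frontier.isOpen_compl.preimage c₀.continuous
      obtain ⟨η, hη, hball⟩ := Metric.isOpen_iff.1 hopen' t ht
      have hst' : (s : ℝ) < t := Subtype.coe_lt_coe.2 hst
      set ur : ℝ := max (((s : ℝ) + t) / 2) (t - η / 2) with hur
      have hsu : (s : ℝ) < ur := lt_of_lt_of_le (by linarith) (le_max_left _ _)
      have hut : ur < t := max_lt (by linarith) (by linarith)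
      have hu0 : 0 ≤ ur := (unitInterval.nonneg s).trans hsu.le
      have hu1 : ur ≤ 1 := hut.le.trans (unitInterval.le_one t)
      have hdist : dist (⟨ur, hu0, hu1⟩ : I) t < η := by
        rw [Subtype.dist_eq, Real.dist_eq, abs_lt]
        have : (t : ℝ) - η / 2 ≤ ur := le_max_right _ _
        constructor
        · show -η < ur - t
          linarith
        · show ur - t < η
          linarith
      exact hball hdist (hfr ⟨ur, hu0, hu1⟩ ⟨Subtype.coe_lt_coe.1 hsu, Subtype.coe_lt_coe.1 hut⟩)
    have hsub : c₀ '' Icc s t ⊆ frontier D.carrier := by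
      rintro _ ⟨u, hu, rfl⟩
      rcases hu.1.eq_or_lt with h | hsu
      · rw [← h]; exact hs'
      rcases hu.2.eq_or_lt with h | hut
      · rw [h]; exact ht'
      exact hfr u ⟨hsu, hut⟩
    obtain ⟨u, hsu, hut, hne⟩ := hlight s t hst
    exact hne ((hnt s t hst hsub) (mem_image_of_mem _ ⟨hsu, hut⟩)
      (mem_image_of_mem _ (left_mem_Icc.2 hst.le)))
  obtain ⟨u₀, ⟨hsu₀, hu₀t⟩, hu₀D⟩ := hint
  obtain ⟨μ, hμ, hball⟩ := Metric.isOpen_iff.1 hopen _ hu₀D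
  ---------------------------------------------------------------- the piece `[p, q]`
  have hpre : IsOpen {u : I | dist (c₀ u) (c₀ u₀) < μ / 3} :=
    isOpen_lt (c₀.continuous.dist continuous_const) continuous_const
  obtain ⟨η, hη, hηball⟩ := Metric.isOpen_iff.1 hpre u₀ (by
    show dist (c₀ u₀) (c₀ u₀) < μ / 3
    rw [dist_self]; positivity)
  have hsu₀' : (s : ℝ) < u₀ := Subtype.coe_lt_coe.2 hsu₀
  set pr : ℝ := max (((s : ℝ) + u₀) / 2) (u₀ - η / 2) with hpr
  have hsp : (s : ℝ) < pr := lt_of_lt_of_le (by linarith) (le_max_left _ _)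
  have hpu₀ : pr < u₀ := max_lt (by linarith) (by linarith)
  have hp0 : 0 ≤ pr := (unitInterval.nonneg s).trans hsp.le
  have hp1 : pr ≤ 1 := hpu₀.le.trans (unitInterval.le_one u₀)
  set p : I := ⟨pr, hp0, hp1⟩ with hp
  have hsp' : s < p := Subtype.coe_lt_coe.1 hsp
  have hpu₀' : p < u₀ := Subtype.coe_lt_coe.1 hpu₀
  have hp_near : ∀ u : I, p ≤ u → u ≤ u₀ → dist (c₀ u) (c₀ u₀) < μ / 3 := by
    intro u hu1 hu2
    refine hηball ?_
    rw [mem_ball, Subtype.dist_eq, Real.dist_eq, abs_lt]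
    have hu1' : pr ≤ (u : ℝ) := Subtype.coe_le_coe.2 hu1
    have hu2' : (u : ℝ) ≤ u₀ := Subtype.coe_le_coe.2 hu2
    have : (u₀ : ℝ) - η / 2 ≤ pr := le_max_right _ _
    constructor <;> linarith
  obtain ⟨q, hpq, hqu₀, hne⟩ := hlight p u₀ hpu₀'
  have hpq' : p < q := lt_of_le_of_ne hpq fun h => hne (by rw [h])
  have hqt : q < t := lt_of_le_of_lt hqu₀ hu₀t
  have hmargin : ∀ u : I, p ≤ u → u ≤ q → ball (c₀ u) (2 * μ / 3) ⊆ D.carrier := by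
    intro u hu1 hu2 z hz
    apply hball
    rw [mem_ball] at hz ⊢
    have := hp_near u hu1 (hu2.trans hqu₀)
    linarith [dist_triangle z (c₀ u) (c₀ u₀)]
  have hfront : ∀ u : I, p ≤ u → u ≤ q → ∀ w ∈ frontier D.carrier, 2 * μ / 3 ≤ dist (c₀ u) w := by
    intro u hu1 hu2 w hw
    by_contra hlt
    push Not at hlt
    have hwD : w ∈ D.carrier := hmargin u hu1 hu2 (by rw [mem_ball, dist_comm]; exact hlt)
    have : w ∈ D.carrier ∩ frontier D.carrier := ⟨hwD, hw⟩
    rw [hopen.inter_frontier_eq] at this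
    exact this
  ---------------------------------------------------------------- the scales
  set d : ℝ := dist (c₀ p) (c₀ q) with hd
  have hdpos : 0 < d := dist_pos.2 (Ne.symm hne)
  refine ⟨min (μ / 6) (d / 8), by positivity, ?_⟩
  intro R hR hRle ε hε hεR L hL
  have hRμ : R ≤ μ / 6 := hRle.trans (min_le_left _ _)
  have hRd : R ≤ d / 8 := hRle.trans (min_le_right _ _)
  ---------------------------------------------------------------- the projection on the chord
  set v : ℂ := c₀ q - c₀ p with hv
  have hvn : ‖v‖ = d := by rw [hv, hd, dist_comm, dist_eq_norm]
  set φ : I → ℝ := fun u => ((starRingEnd ℂ) v * (c₀ u - c₀ p)).re / d with hφ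
  have hφc : Continuous φ := by
    refine Continuous.div_const (Complex.continuous_re.comp (continuous_const.mul ?_)) d
    exact c₀.continuous.sub continuous_const
  have hφp : φ p = 0 := by simp [hφ]
  have hφq : φ q = d := by
    simp only [hφ]
    rw [← hv, ← Complex.normSq_eq_conj_mul_self, Complex.ofReal_re, Complex.normSq_eq_norm_sq,
      hvn, sq, mul_div_cancel_right₀ _ hdpos.ne']
  have hφlip : ∀ u u' : I, |φ u - φ u'| ≤ dist (c₀ u) (c₀ u') := by
    intro u u'
    simp only [hφ]
    rw [← sub_div, ← Complex.sub_re, ← mul_sub, abs_div, abs_of_pos hdpos,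
      div_le_iff₀ hdpos, show c₀ u - c₀ p - (c₀ u' - c₀ p) = c₀ u - c₀ u' by ring]
    have h1 := Complex.abs_re_le_norm ((starRingEnd ℂ) v * (c₀ u - c₀ u'))
    rw [norm_mul, Complex.norm_conj, hvn, ← dist_eq_norm] at h1
    linarith
  ---------------------------------------------------------------- the levels and the points
  set N : ℕ := ⌊R / ε⌋₊ with hN
  have hNε : (N : ℝ) * ε ≤ R := by
    have := Nat.floor_le (show 0 ≤ R / ε by positivity)
    rw [← hN] at this
    have := mul_le_mul_of_nonneg_right this hε.le
    rwa [div_mul_cancel₀ _ hε.ne'] at this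
  have hlev : ∀ i : ℕ, i ≤ N → d / 2 + 3 * ε * i ∈ Icc (φ p) (φ q) := by
    intro i hi
    rw [hφp, hφq]
    have hi' : (i : ℝ) ≤ N := by exact_mod_cast hi
    constructor
    · positivity
    · nlinarith
  have hex : ∀ i : ℕ, ∃ u : I, i ≤ N → (u ∈ Icc p q ∧ φ u = d / 2 + 3 * ε * i) := by
    intro i
    by_cases hi : i ≤ N
    · obtain ⟨u, hu, hφu⟩ := intermediate_value_Icc hpq'.le hφc.continuousOn (hlev i hi)
      exact ⟨u, fun _ => ⟨hu, hφu⟩⟩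
    · exact ⟨p, fun h => absurd h hi⟩
  choose uf huf using hex
  set z : ℕ → ℂ := fun i => c₀ (uf i) with hz
  set gi : ℕ → ℂ := fun i =>
    ((ε * round ((z i).re / ε) : ℝ) : ℂ) + ((ε * round ((z i).im / ε) : ℝ) : ℂ) * Complex.I with hgi
  have hgz : ∀ i, dist (gi i) (z i) ≤ ε := fun i => dist_round_grid_le hε (z i)
  -- distances from `c₀ p` and between the points
  have hfar_p : ∀ i, i ≤ N → d / 2 ≤ dist (z i) (c₀ p) := by
    intro i hi
    obtain ⟨-, hφu⟩ := huf i hi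
    have h := hφlip (uf i) p
    rw [hφu, hφp, sub_zero, abs_of_nonneg (by positivity)] at h
    have : (0 : ℝ) ≤ 3 * ε * i := by positivity
    exact le_trans (by linarith) h
  have hsep : ∀ i j, i ≤ N → j ≤ N → i ≠ j → 3 * ε ≤ dist (z i) (z j) := by
    intro i j hi hj hij
    obtain ⟨-, hφi⟩ := huf i hi
    obtain ⟨-, hφj⟩ := huf j hj
    have h := hφlip (uf i) (uf j)
    rw [hφi, hφj] at h
    have h1 : |d / 2 + 3 * ε * i - (d / 2 + 3 * ε * j)| = 3 * ε * |(i : ℝ) - j| := by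
      rw [show d / 2 + 3 * ε * i - (d / 2 + 3 * ε * j) = 3 * ε * ((i : ℝ) - j) by ring, abs_mul,
        abs_of_pos (by positivity : (0 : ℝ) < 3 * ε)]
    rw [h1] at h
    have h2 : (1 : ℝ) ≤ |(i : ℝ) - j| := by
      rcases lt_or_gt_of_ne hij with hlt | hlt
      · have : (i : ℝ) + 1 ≤ j := by exact_mod_cast hlt
        rw [abs_of_neg (by linarith)]; linarith
      · have : (j : ℝ) + 1 ≤ i := by exact_mod_cast hlt
        rw [abs_of_pos (by linarith)]; linarith
    nlinarith
  ---------------------------------------------------------------- the grid points qualify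
  have hfrne : (frontier D.carrier).Nonempty := ⟨_, h0⟩
  have hqual : ∀ i, i ≤ N → gi i ∈ (sqGrid ε L).filter fun g =>
      2 * R ≤ infDist g (frontier D.carrier) ∧ CurveClass.mk c₀ ∈ altEvent g (2 * ε) R := by
    intro i hi
    obtain ⟨⟨hpu, huq⟩, hφu⟩ := huf i hi
    refine Finset.mem_filter.2 ⟨?_, ?_, ?_⟩
    · -- in the grid
      have hzR : ‖z i‖ ≤ Rad := hRad _
      refine mem_sqGrid ?_ ?_
      · have := abs_round_div_le hε ((Complex.abs_re_le_norm (z i)).trans hzR)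
        have : |((round ((z i).re / ε) : ℤ) : ℝ)| ≤ (L : ℝ) := this.trans hL
        exact_mod_cast this
      · have := abs_round_div_le hε ((Complex.abs_im_le_norm (z i)).trans hzR)
        have : |((round ((z i).im / ε) : ℤ) : ℝ)| ≤ (L : ℝ) := this.trans hL
        exact_mod_cast this
    · -- in the bulk
      have hzi : 2 * μ / 3 ≤ infDist (z i) (frontier D.carrier) :=
        (le_infDist hfrne).2 fun w hw => hfront (uf i) hpu huq w hw
      have := infDist_le_infDist_add_dist (x := z i) (y := gi i) (s := frontier D.carrier)
      rw [dist_comm] at this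
      linarith [hgz i]
    · -- the alternation
      have hut : uf i ∈ Ioo s t := ⟨hsp'.trans_le hpu, lt_of_le_of_lt huq hqt⟩
      obtain ⟨u₁, hu₁, hu₁z⟩ := hpast (uf i) hut
      have hpui : p < uf i := by
        refine lt_of_le_of_ne hpu fun h => ?_
        have := hfar_p i hi
        rw [hz] at this
        simp only [← h, dist_self] at this
        linarith
      refine mk_mem_altEvent_iff.2 ⟨u₁, p, uf i, lt_of_le_of_lt hu₁.2 hsp', hpui, ?_, ?_, ?_, ?_, ?_⟩
      · rw [hu₁z]
        have := hgz i
        rw [dist_comm] at this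
        show dist (z i) (gi i) < 2 * ε
        linarith
      · have h2 := hfar_p i hi
        show R < dist (c₀ p) (gi i)
        linarith [dist_triangle (z i) (gi i) (c₀ p), dist_comm (z i) (gi i), hgz i,
          dist_comm (gi i) (c₀ p)]
      · show dist (z i) (gi i) < 2 * ε
        linarith [hgz i, dist_comm (z i) (gi i)]
      · have h2 : 2 * μ / 3 ≤ dist (z i) (c₀ 0) := hfront (uf i) hpu huq _ h0
        show R < dist (c₀ 0) (gi i)
        linarith [dist_triangle (z i) (gi i) (c₀ 0), hgz i, dist_comm (z i) (gi i),
          dist_comm (gi i) (c₀ 0)]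
      · have h2 : 2 * μ / 3 ≤ dist (z i) (c₀ 1) := hfront (uf i) hpu huq _ h1
        show R < dist (c₀ 1) (gi i)
        linarith [dist_triangle (z i) (gi i) (c₀ 1), hgz i, dist_comm (z i) (gi i),
          dist_comm (gi i) (c₀ 1)]
  ---------------------------------------------------------------- counting
  have hinj : Set.InjOn gi (Finset.range (N + 1) : Set ℕ) := by
    intro i hi j hj hij
    have hi' : i ≤ N := Nat.lt_succ_iff.1 (Finset.mem_range.1 hi)
    have hj' : j ≤ N := Nat.lt_succ_iff.1 (Finset.mem_range.1 hj)
    by_contra hne'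
    have h3 := hsep i j hi' hj' hne'
    have : dist (z i) (z j) ≤ 2 * ε := by
      have h4 : dist (gi i) (gi j) = 0 := by rw [hij, dist_self]
      linarith [dist_triangle (z i) (gi i) (z j), dist_triangle (gi i) (gi j) (z j), hgz i, hgz j,
        dist_comm (z i) (gi i)]
    linarith
  calc N + 1 = ((Finset.range (N + 1)).image gi).card := by
        rw [Finset.card_image_of_injOn hinj, Finset.card_range]
    _ ≤ _ := Finset.card_le_card fun g hg => by
        obtain ⟨i, hi, rfl⟩ := Finset.mem_image.1 hg
        exact hqual i (Nat.lt_succ_iff.1 (Finset.mem_range.1 hi))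

open scoped Classical in
/-- **Registered sub-stub `stub_noIdle_doublePoints`** (line `hitting-tournament`, stub
`stub_limitCurveRegularity_noIdle`, helper 7): `exists_forall_le_card_filter_altEvent` with all
arguments explicit. [cite: KemppainenSmirnov2017, Thm. 1.5] -/
theorem stub_noIdle_doublePoints : ∀ (D : DobrushinDomain) (c₀ : Curve ℂ), (∀ s t : unitInterval, s < t → ∃ u, s ≤ u ∧ u ≤ t ∧ c₀ u ≠ c₀ s) → (∀ u, c₀ u ∈ closure D.carrier) → c₀ 0 ∈ frontier D.carrier → c₀ 1 ∈ frontier D.carrier → (∀ p q : unitInterval, p < q → c₀ '' Set.Icc p q ⊆ frontier D.carrier → (c₀ '' Set.Icc p q).Subsingleton) → ∀ (s t : unitInterval), s < t → (∀ u ∈ Set.Ioo s t, c₀ u ∈ c₀ '' Set.Icc 0 s) → ∀ (Rad : ℝ), (∀ u, ‖c₀ u‖ ≤ Rad) → ∃ R₀ : ℝ, 0 < R₀ ∧ ∀ R : ℝ, 0 < R → R ≤ R₀ → ∀ ε : ℝ, 0 < ε → 1000 * ε ≤ R → ∀ L : ℕ, Rad / ε + 1 ≤ L → ⌊R / ε⌋₊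 + 1 ≤ ((sqGrid ε L).filter fun g => 2 * R ≤ Metric.infDist g (frontier D.carrier) ∧ CurveClass.mk c₀ ∈ altEvent g (2 * ε) R).card :=
  fun D _ hlight hcl h0 h1 hnt _ _ hst hpast _ hRad =>
    exists_forall_le_card_filter_altEvent D hlight hcl h0 h1 hnt hst hpast hRad

end Summit.CriticalPhenomena.CardyFormulaZ2.Cruxes.LagHandOff.HittingTournament

end
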